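/-
Origin: expansion seat `planner-pub-hodgecm-pv06-g5-0`, handover #1 2026-08-18T11:26Z md5 da40467a4fe9; imports tree HodgeCM.PerL34.AdelicUnitaryFactorisation + HodgeCM.Proofs.LandherrHermSpace3 + HodgeCM.Vendored.H21.NumberTheory.Automorphic.IwasawaDecompositionArchimedean + Mathlib.Analysis.Matrix.Order only (no rewrite); as-landed = source verbatim (`HOME/pub-hodgecm-pv06-g5/lean/Pv06g5/ArchCompactK.lean`, md5 da40467a, 413 lines);
landed by the gen-8 packager in gate run 29 as `HodgeCM/PerL34/ArchCompactK.lean` (stripped 7 #print/#check/#eval lines).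
-/
/-
Origin: pub-hodgecm cell, unit pub-hodgecm-pv06-g5 (DAG-NODE PROVER #06, generation 5), 2026-08-18.
Target path in the package: `HodgeCM/PerL34/ArchCompactK.lean` (imports are TREE modules only — no rewrite).

# The archimedean compact subgroup `K_∞ ≤ U(H)(L₀ ⊗ ℝ)` (KERNEL; SETUP class D3, archimedean half)

PerL v5 ll. 72–73: "for torsion-free `Γ`, `P^L_Γ := Γ\𝔹²` is a smooth projective surface", with
`𝔹² = G_U(ℝ)/K_∞` (times a point for the compact factors `U(3)` at the definite places); ll. 239–256
(forms on `G_U(L₀)\G_U(𝔸)/K_f`, `K_∞`-types); l. 677 ("`K_x ≅ U(2) × U(1)`").  The tree's D3 dictionary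
(`HodgeCM/PerL34/AdelicUnitaryFactorisation.lean`, pv06-g4, run 26) realises `G_U(ℝ) = U(H)(L₀ ⊗ ℝ)` as the
closed subgroup `Uinf L H ≤ GL_n(L ⊗ ℝ)` with `archEquiv : Uinf L H ≃ₜ* ∏_{w ∣ ∞} U(H^{w})`
(`unitaryPiSubmonoid`, pv06-g2).  The group-level smoothness statement
(`HodgeCM.HermSpace3.stabilizer_congruenceLattice_eq_bot`, pv10-g4 `TorsionFreeAction`, run-29 queue) is
stated for an ARBITRARY compact subgroup `C ≤ Uinf L V.Hm` ("e.g. a maximal compact `K_∞`").  THIS FILE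
CONSTRUCTS that `K_∞` and PROVES IT COMPACT — nothing cited, nothing posited:

* §1 (Mathlib + the vendored `Matrix.isCompact_unitaryGroup`)  **definite unitary groups are compact**:
  `isCompact_hUnitarySet : H.PosDef → IsCompact {g : M_n(ℂ) | gᴴ H g = H}` — `H = Bᴴ B` with `B`
  invertible (`CStarAlgebra.nonneg_iff_eq_star_mul_self` for the matrix order), and `g ↦ B g B⁻¹` carries
  `U(H)` into the compact `U(n)`.
* §2  at an INDEFINITE place: for ANY `H` and ANY frame `T ∈ GL_n(ℂ)` the set
  `frameSet H T = {g | gᴴ H g = H ∧ (T⁻¹ g T)ᴴ (T⁻¹ g T) = 1}` ("`U(H) ∩ T·U(n)·T⁻¹`") is compact; and when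
  `T` is a SYLVESTER frame (`Tᴴ H T = J`, `J² = 1` — e.g. `J = diag(1,1,-1)`) it is EXACTLY
  `{g ∈ U(H) | T⁻¹ g T commutes with J}` = `T · (U(J) ∩ U(n)) · T⁻¹`, i.e. the block-diagonal `U(p) × U(q)` of
  the frame (`mem_frameSet_iff_commute`): the standard maximal compact subgroup of `U(p,q)` (maximality itself —
  Cartan's fixed-point theorem — is not needed by any consumer and is not claimed).
* §3  `archK L H S T : Subgroup (Uinf L H)` — the elements whose local component at each place `w ∈ S` lies in
  `T_w · U(n) · T_w⁻¹` (no condition off `S`) — and **`isCompact_archK`**: if `H^{w}` is positive definite at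
  every `w ∉ S`, then `archK L H S T` is compact (transport along `archEquiv`, Tychonoff over the places,
  §1 off `S`, §2 on `S`).
* §4  PerL's case: `V : HermSpace3 L ι₁` (signature `(2,1)` at `ι₁`, definite elsewhere, `CM/Basic.lean`),
  `S = {place of ι₁}`: `HermSpace3.archK V T` is a compact subgroup of `G_U(ℝ) = Uinf L V.Hm` for EVERY
  `T ∈ GL₃(ℂ)` (`HermSpace3.isCompact_archK`, hypothesis-free), and a Sylvester frame at the place of `ι₁`
  exists (`HermSpace3.exists_frame_place` — `signature_ι₁` is stated for the embedding `ι₁`; the place's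
  chosen `embedding` is `ι₁` or its conjugate, and conjugating a frame entrywise handles the second case), for
  which `archK` is `U(2) × U(1) × ∏_{w ≠ ι₁} U(3)` in coordinates.

So `C := HermSpace3.archK V T` discharges the `(C, hC)` binders of pv10-g4's `finite_stabilizer_congruenceLattice`
/ `stabilizer_congruenceLattice_eq_bot` / `smul_eq_self_iff_of_torsionFree` (when that file lands), giving the
orbifold / free-action statements on `G_U(ℝ)/K_∞ = 𝔹² × pt` unconditionally.  No node of LEMMAS.md §1 is
claimed (v17: queue empty); this is an additive D3 leaf of the pv06 lineage (owner of `Uinf` / `archEquiv`).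
Fully proved — no placeholders, no posited constants; closures are the standard trio (see the `#print axioms` at the end).
-/
import Summits.HodgeConjecture.HodgeCM.PerL34.AdelicUnitaryFactorisation
import Summits.HodgeConjecture.HodgeCM.Proofs.LandherrHermSpace3
import Literature.NumberTheory.Automorphic.IwasawaDecompositionArchimedean
import Mathlib.Analysis.Matrix.Order

set_option autoImplicit false

noncomputable section

open scoped Matrix ComplexOrder MatrixOrder
open NumberField NumberField.InfinitePlace Topology

namespace HodgeCM.PerL34.ArchCompactK

/-! ## §1  Definite unitary groups are compact -/

section MatrixLevel

variable {n : Type*} [Fintype n]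

/-- `U(H) = {g | gᴴ H g = H}` as a set of complex matrices. -/
def hUnitarySet (H : Matrix n n ℂ) : Set (Matrix n n ℂ) := {g | gᴴ * H * g = H}

/-- (Ported verbatim from the HodgeCMPerL package; no docstring in the source.) -/
@[simp] theorem mem_hUnitarySet_iff (H g : Matrix n n ℂ) : g ∈ hUnitarySet H ↔ gᴴ * H * g = H := Iff.rfl

/-- (Ported verbatim from the HodgeCMPerL package; no docstring in the source.) -/
theorem isClosed_hUnitarySet (H : Matrix n n ℂ) : IsClosed (hUnitarySet H) :=
  isClosed_eq ((continuous_id.matrix_conjTranspose.matrix_mul continuous_const).matrix_mul continuous_id)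
    continuous_const

/-- Conjugation `u ↦ P u Q` is continuous. -/
theorem continuous_conj (P Q : Matrix n n ℂ) : Continuous fun u : Matrix n n ℂ => P * u * Q :=
  (continuous_const.matrix_mul continuous_id).matrix_mul continuous_const

variable [DecidableEq n]

/-- The unit matrices `{u | uᴴ u = 1}` form a compact set (vendored `Matrix.isCompact_unitaryGroup`). -/
theorem isCompact_unitarySet : IsCompact {u : Matrix n n ℂ | uᴴ * u = 1} := by
  have h : {u : Matrix n n ℂ | uᴴ * u = 1} = (Matrix.unitaryGroup n ℂ : Set (Matrix n n ℂ)) := by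
    ext u
    simp only [Set.mem_setOf_eq, SetLike.mem_coe, Matrix.mem_unitaryGroup_iff', Matrix.star_eq_conjTranspose]
  rw [h]
  exact Literature.NumberTheory.Automorphic.Matrix.isCompact_unitaryGroup

/-- If `H = Bᴴ B` with `B` invertible (`B B' = 1`), then `U(H) ⊆ B⁻¹ · U(n) · B`. -/
theorem hUnitarySet_subset_image {H B B' : Matrix n n ℂ} (hH : H = Bᴴ * B) (hBB' : B * B' = 1)
    (hB'B : B' * B = 1) :
    hUnitarySet H ⊆ (fun u : Matrix n n ℂ => B' * u * B) '' {u : Matrix n n ℂ | uᴴ * u = 1} := by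
  intro g hg
  rw [mem_hUnitarySet_iff, hH] at hg
  refine ⟨B * g * B', ?_, ?_⟩
  · show (B * g * B')ᴴ * (B * g * B') = 1
    calc (B * g * B')ᴴ * (B * g * B')
        = B'ᴴ * (gᴴ * (Bᴴ * B) * g) * B' := by
          simp only [Matrix.conjTranspose_mul, Matrix.mul_assoc]
      _ = B'ᴴ * (Bᴴ * B) * B' := by rw [hg]
      _ = (B * B')ᴴ * (B * B') := by simp only [Matrix.conjTranspose_mul, Matrix.mul_assoc]
      _ = 1 := by rw [hBB', Matrix.conjTranspose_one, Matrix.one_mul]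
  · show B' * (B * g * B') * B = g
    calc B' * (B * g * B') * B = (B' * B) * g * (B' * B) := by simp only [Matrix.mul_assoc]
      _ = g := by rw [hB'B, Matrix.one_mul, Matrix.mul_one]

/-- A positive definite complex matrix is `Bᴴ B` with `B` invertible. -/
theorem exists_factor_of_posDef {H : Matrix n n ℂ} (hH : H.PosDef) :
    ∃ B B' : Matrix n n ℂ, H = Bᴴ * B ∧ B * B' = 1 ∧ B' * B = 1 := by
  obtain ⟨B, hB⟩ := CStarAlgebra.nonneg_iff_eq_star_mul_self.mp hH.posSemidef.nonneg
  rw [Matrix.star_eq_conjTranspose] at hB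
  have hBdet : IsUnit B.det := by
    have hdet : IsUnit H.det := (Matrix.isUnit_iff_isUnit_det _).mp hH.isUnit
    rw [hB, Matrix.det_mul] at hdet
    exact isUnit_of_mul_isUnit_right hdet
  exact ⟨B, B⁻¹, hB, Matrix.mul_nonsing_inv _ hBdet, Matrix.nonsing_inv_mul _ hBdet⟩

/-- **Definite unitary groups are compact**: for `H` positive definite, `U(H) = {g | gᴴ H g = H}` is a
compact set of matrices. -/
theorem isCompact_hUnitarySet {H : Matrix n n ℂ} (hH : H.PosDef) : IsCompact (hUnitarySet H) := by
  obtain ⟨B, B', hHB, hBB', hB'B⟩ := exists_factor_of_posDef hH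
  exact (isCompact_unitarySet.image (continuous_conj B' B)).of_isClosed_subset (isClosed_hUnitarySet H)
    (hUnitarySet_subset_image hHB hBB' hB'B)

/-! ## §2  The compact piece at an indefinite place: `U(H) ∩ T·U(n)·T⁻¹` -/

/-- `frameSet H T = {g | gᴴ H g = H ∧ (T⁻¹ g T)ᴴ (T⁻¹ g T) = 1}`: the elements of `U(H)` which are unitary
in the frame `T`. -/
def frameSet (H : Matrix n n ℂ) (T : GL n ℂ) : Set (Matrix n n ℂ) :=
  {g | gᴴ * H * g = H ∧
    (((T⁻¹ : GL n ℂ) : Matrix n n ℂ) * g * (T : Matrix n n ℂ))ᴴ *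
      (((T⁻¹ : GL n ℂ) : Matrix n n ℂ) * g * (T : Matrix n n ℂ)) = 1}

/-- (Ported verbatim from the HodgeCMPerL package; no docstring in the source.) -/
theorem mem_frameSet_iff (H : Matrix n n ℂ) (T : GL n ℂ) (g : Matrix n n ℂ) :
    g ∈ frameSet H T ↔ gᴴ * H * g = H ∧
      (((T⁻¹ : GL n ℂ) : Matrix n n ℂ) * g * (T : Matrix n n ℂ))ᴴ *
        (((T⁻¹ : GL n ℂ) : Matrix n n ℂ) * g * (T : Matrix n n ℂ)) = 1 := Iff.rfl

/-- (Ported verbatim from the HodgeCMPerL package; no docstring in the source.) -/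
theorem frameSet_subset_hUnitarySet (H : Matrix n n ℂ) (T : GL n ℂ) : frameSet H T ⊆ hUnitarySet H :=
  fun _ hg => hg.1

/-- (Ported verbatim from the HodgeCMPerL package; no docstring in the source.) -/
theorem coe_inv_mul_coe (T : GL n ℂ) :
    ((T⁻¹ : GL n ℂ) : Matrix n n ℂ) * (T : Matrix n n ℂ) = 1 := by
  rw [← Units.val_mul, inv_mul_cancel, Units.val_one]

/-- (Ported verbatim from the HodgeCMPerL package; no docstring in the source.) -/
theorem coe_mul_coe_inv (T : GL n ℂ) :
    (T : Matrix n n ℂ) * ((T⁻¹ : GL n ℂ) : Matrix n n ℂ) = 1 := by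
  rw [← Units.val_mul, mul_inv_cancel, Units.val_one]

/-- (Ported verbatim from the HodgeCMPerL package; no docstring in the source.) -/
theorem isClosed_frameSet (H : Matrix n n ℂ) (T : GL n ℂ) : IsClosed (frameSet H T) := by
  refine (isClosed_hUnitarySet H).inter (isClosed_eq ?_ continuous_const)
  exact (continuous_conj _ _).matrix_conjTranspose.matrix_mul (continuous_conj _ _)

/-- `frameSet H T ⊆ T · U(n) · T⁻¹`. -/
theorem frameSet_subset_image (H : Matrix n n ℂ) (T : GL n ℂ) :
    frameSet H T ⊆ (fun u : Matrix n n ℂ => (T : Matrix n n ℂ) * u * ((T⁻¹ : GL n ℂ) : Matrix n n ℂ)) ''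
      {u : Matrix n n ℂ | uᴴ * u = 1} := by
  intro g hg
  refine ⟨((T⁻¹ : GL n ℂ) : Matrix n n ℂ) * g * (T : Matrix n n ℂ), hg.2, ?_⟩
  show (T : Matrix n n ℂ) * (((T⁻¹ : GL n ℂ) : Matrix n n ℂ) * g * (T : Matrix n n ℂ)) *
      ((T⁻¹ : GL n ℂ) : Matrix n n ℂ) = g
  calc (T : Matrix n n ℂ) * (((T⁻¹ : GL n ℂ) : Matrix n n ℂ) * g * (T : Matrix n n ℂ)) *
        ((T⁻¹ : GL n ℂ) : Matrix n n ℂ)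
      = ((T : Matrix n n ℂ) * ((T⁻¹ : GL n ℂ) : Matrix n n ℂ)) * g *
          ((T : Matrix n n ℂ) * ((T⁻¹ : GL n ℂ) : Matrix n n ℂ)) := by simp only [Matrix.mul_assoc]
    _ = g := by rw [coe_mul_coe_inv, Matrix.one_mul, Matrix.mul_one]

/-- **The frame-compact piece is compact**, for every `H` and every frame `T`. -/
theorem isCompact_frameSet (H : Matrix n n ℂ) (T : GL n ℂ) : IsCompact (frameSet H T) :=
  (isCompact_unitarySet.image (continuous_conj _ _)).of_isClosed_subset (isClosed_frameSet H T)
    (frameSet_subset_image H T)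

/-- In a frame `T`, `g ↦ u := T⁻¹ g T` carries `U(H)` to `U(Tᴴ H T)`. -/
theorem conj_mem_hUnitarySet {H : Matrix n n ℂ} (T : GL n ℂ) {g : Matrix n n ℂ} (hg : gᴴ * H * g = H) :
    (((T⁻¹ : GL n ℂ) : Matrix n n ℂ) * g * (T : Matrix n n ℂ))ᴴ *
        ((T : Matrix n n ℂ)ᴴ * H * (T : Matrix n n ℂ)) *
      (((T⁻¹ : GL n ℂ) : Matrix n n ℂ) * g * (T : Matrix n n ℂ)) =
      (T : Matrix n n ℂ)ᴴ * H * (T : Matrix n n ℂ) := by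
  calc (((T⁻¹ : GL n ℂ) : Matrix n n ℂ) * g * (T : Matrix n n ℂ))ᴴ *
          ((T : Matrix n n ℂ)ᴴ * H * (T : Matrix n n ℂ)) *
        (((T⁻¹ : GL n ℂ) : Matrix n n ℂ) * g * (T : Matrix n n ℂ))
      = (T : Matrix n n ℂ)ᴴ * gᴴ * ((T : Matrix n n ℂ) * ((T⁻¹ : GL n ℂ) : Matrix n n ℂ))ᴴ * H *
          ((T : Matrix n n ℂ) * ((T⁻¹ : GL n ℂ) : Matrix n n ℂ)) * g * (T : Matrix n n ℂ) := by
        simp only [Matrix.conjTranspose_mul, Matrix.mul_assoc]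
    _ = (T : Matrix n n ℂ)ᴴ * (gᴴ * H * g) * (T : Matrix n n ℂ) := by
        rw [coe_mul_coe_inv, Matrix.conjTranspose_one, Matrix.mul_one, Matrix.mul_one]
        simp only [Matrix.mul_assoc]
    _ = (T : Matrix n n ℂ)ᴴ * H * (T : Matrix n n ℂ) := by rw [hg]

/-- **The frame-compact piece in a Sylvester frame.**  If `Tᴴ H T = J` with `J² = 1` (e.g. the signature
matrix `J = diag(1,…,1,-1,…,-1)`), then `g ∈ frameSet H T` iff `g ∈ U(H)` and `T⁻¹ g T` COMMUTES with `J` — i.e.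
`frameSet H T = T · (U(J) ∩ {u | uJ = Ju}) · T⁻¹ = T · (U(p) × U(q)) · T⁻¹`, the block-diagonal subgroup of
the frame. -/
theorem mem_frameSet_iff_commute {H J : Matrix n n ℂ} {T : GL n ℂ}
    (hT : (T : Matrix n n ℂ)ᴴ * H * (T : Matrix n n ℂ) = J) (hJJ : J * J = 1) (g : Matrix n n ℂ) :
    g ∈ frameSet H T ↔ gᴴ * H * g = H ∧
      ((T⁻¹ : GL n ℂ) : Matrix n n ℂ) * g * (T : Matrix n n ℂ) * J =
        J * (((T⁻¹ : GL n ℂ) : Matrix n n ℂ) * g * (T : Matrix n n ℂ)) := by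
  rw [mem_frameSet_iff]
  refine and_congr_right fun hg => ?_
  -- `u := T⁻¹ g T` preserves `J`
  set u : Matrix n n ℂ := ((T⁻¹ : GL n ℂ) : Matrix n n ℂ) * g * (T : Matrix n n ℂ) with hu
  have huJ : uᴴ * J * u = J := by rw [hu, ← hT]; exact conj_mem_hUnitarySet T hg
  constructor
  · -- unitary and `J`-preserving ⇒ commutes with `J`
    intro h1
    calc u * J = u * (uᴴ * J * u) := by rw [huJ]
      _ = (u * uᴴ) * J * u := by simp only [Matrix.mul_assoc]
      _ = J * u := by rw [mul_eq_one_comm.mp h1, Matrix.one_mul]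
  · -- commutes with `J` and `J`-preserving ⇒ unitary (`J² = 1`)
    intro hc
    have h2 : uᴴ * u * J = J := by
      calc uᴴ * u * J = uᴴ * (u * J) := by simp only [Matrix.mul_assoc]
        _ = uᴴ * (J * u) := by rw [hc]
        _ = uᴴ * J * u := by simp only [Matrix.mul_assoc]
        _ = J := huJ
    calc uᴴ * u = uᴴ * u * (J * J) := by rw [hJJ, Matrix.mul_one]
      _ = (uᴴ * u * J) * J := by simp only [Matrix.mul_assoc]
      _ = J * J := by rw [h2]
      _ = 1 := hJJ

end MatrixLevel

/-! ## §3  `K_{S,T} ≤ U(H)(L₀ ⊗ ℝ)`: frame-unitary at the places in `S` -/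

section Arch

open HodgeCM.PerL34.AdelicUnitaryFactorisation HodgeCM.Literature.RealApproximation

/-- Membership in Mathlib's `unitarySubgroup (GL_n ℂ)`: `gᴴ g = 1` as matrices. -/
theorem mem_unitarySubgroup_GL_iff {n : Type*} [Fintype n] [DecidableEq n] (g : GL n ℂ) :
    g ∈ unitarySubgroup (GL n ℂ) ↔ (g : Matrix n n ℂ)ᴴ * (g : Matrix n n ℂ) = 1 := by
  rw [mem_unitarySubgroup_iff, (Group.isUnit g).mem_unitary_iff_star_mul_self, Units.ext_iff, Units.val_mul,
    Units.coe_star, Units.val_one, Matrix.star_eq_conjTranspose]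

variable (L : Type) [Field L] [NumberField L] [IsCMField L] {n : Type} [Fintype n] [DecidableEq n]
  (H : Matrix n n L)

/-- The local component `g_w ∈ M_n(ℂ)` at the infinite place `w` of `g ∈ U(H)(L₀ ⊗ ℝ) = Uinf L H`
(`= (archEquiv L hdet g) w`, `coe_archEquiv_eq_loc`, but defined without the hypothesis `det H ≠ 0`). -/
def loc (g : Uinf L H) (w : InfinitePlace L) : Matrix n n ℂ :=
  matPi L n ((g : GL n (InfiniteAdeleRing L)) : Matrix n n (InfiniteAdeleRing L)) w

/-- (Ported verbatim from the HodgeCMPerL package; no docstring in the source.) -/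
theorem loc_apply (g : Uinf L H) (w : InfinitePlace L) :
    loc L H g w = matPi L n ((g : GL n (InfiniteAdeleRing L)) : Matrix n n (InfiniteAdeleRing L)) w := rfl

variable {H} in
/-- (Ported verbatim from the HodgeCMPerL package; no docstring in the source.) -/
theorem coe_archEquiv_eq_loc (hdet : IsUnit H.det) (g : Uinf L H) :
    ((archEquiv L hdet g : unitaryPiSubmonoid (cm L) H) : InfinitePlace L → Matrix n n ℂ) = loc L H g := rfl

/-- Each local component preserves the form: `g_wᴴ · H^{w} · g_w = H^{w}`. -/
theorem loc_mem_hUnitarySet (g : Uinf L H) (w : InfinitePlace L) :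
    loc L H g w ∈ hUnitarySet (H.map w.embedding) :=
  (mem_unitaryPiSubmonoid_iff (cm L) H _).1 ((mem_Uinf_iff L H _).1 g.2) w

/-- The local component at `w` as a group homomorphism `Uinf L H →* GL_n(ℂ)`. -/
def locGL (w : InfinitePlace L) : Uinf L H →* GL n ℂ :=
  (Units.map (((Pi.evalRingHom (fun _ : InfinitePlace L => Matrix n n ℂ) w).comp
      (matPi L n).toRingHom).toMonoidHom)).comp (Uinf L H).subtype

/-- (Ported verbatim from the HodgeCMPerL package; no docstring in the source.) -/
@[simp] theorem coe_locGL (w : InfinitePlace L) (g : Uinf L H) :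
    ((locGL L H w g : GL n ℂ) : Matrix n n ℂ) = loc L H g w := rfl

/-- **`K_{S,T} ≤ U(H)(L₀ ⊗ ℝ)`**: the elements whose local component at each place `w ∈ S` is unitary in the
frame `T w` — `(T_w⁻¹ g_w T_w)ᴴ (T_w⁻¹ g_w T_w) = 1`, i.e. `g_w ∈ T_w · U(n) · T_w⁻¹`; no condition at the places
off `S`.  (An intersection of preimages of `U(n) ≤ GL_n(ℂ)` under the homomorphisms
`g ↦ T_w⁻¹ g_w T_w`, hence a subgroup.) -/
def archK (S : Set (InfinitePlace L)) (T : InfinitePlace L → GL n ℂ) : Subgroup (Uinf L H) :=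
  ⨅ w ∈ S, (unitarySubgroup (GL n ℂ)).comap ((MulAut.conj (T w)⁻¹).toMonoidHom.comp (locGL L H w))

variable {H}

/-- (Ported verbatim from the HodgeCMPerL package; no docstring in the source.) -/
theorem mem_archK_iff {S : Set (InfinitePlace L)} {T : InfinitePlace L → GL n ℂ} (g : Uinf L H) :
    g ∈ archK L H S T ↔ ∀ w ∈ S,
      ((((T w)⁻¹ : GL n ℂ) : Matrix n n ℂ) * loc L H g w * ((T w : GL n ℂ) : Matrix n n ℂ))ᴴ *
        ((((T w)⁻¹ : GL n ℂ) : Matrix n n ℂ) * loc L H g w * ((T w : GL n ℂ) : Matrix n n ℂ)) = 1 := by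
  simp only [archK, Subgroup.mem_iInf, Subgroup.mem_comap, MonoidHom.coe_comp, Function.comp_apply,
    MulEquiv.toMonoidHom_eq_coe, MonoidHom.coe_coe, MulAut.conj_apply, inv_inv, mem_unitarySubgroup_GL_iff,
    Units.val_mul, coe_locGL]

/-- Equivalently: the local component at each `w ∈ S` lies in the frame-compact piece `frameSet (H^{w}) (T w)`
(the `U(H^{w})`-condition being automatic). -/
theorem mem_archK_iff_loc_mem_frameSet {S : Set (InfinitePlace L)} {T : InfinitePlace L → GL n ℂ}
    (g : Uinf L H) : g ∈ archK L H S T ↔ ∀ w ∈ S, loc L H g w ∈ frameSet (H.map w.embedding) (T w) := by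
  rw [mem_archK_iff]
  exact ⟨fun h w hw => ⟨loc_mem_hUnitarySet L H g w, h w hw⟩, fun h w hw => (h w hw).2⟩

/-- **`K_{S,T}` is compact** as soon as `H^{w}` is positive definite at every place off `S` (no hypothesis on
the places in `S`, none on the frames `T`).  Transport along `archEquiv : Uinf L H ≃ₜ* ∏_w U(H^{w})`;
there `K_{S,T}` is the trace of the box `∏_{w ∈ S} frameSet × ∏_{w ∉ S} U(H^{w})`, compact by §2, §1 and
Tychonoff. -/
theorem isCompact_archK (hdet : IsUnit H.det) (S : Set (InfinitePlace L)) (T : InfinitePlace L → GL n ℂ)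
    (hS : ∀ w, w ∉ S → (H.map w.embedding).PosDef) : IsCompact (archK L H S T : Set (Uinf L H)) := by
  classical
  let F : InfinitePlace L → Set (Matrix n n ℂ) := fun w =>
    if w ∈ S then frameSet (H.map w.embedding) (T w) else hUnitarySet (H.map w.embedding)
  have hF : ∀ w, IsCompact (F w) := fun w => by
    by_cases hw : w ∈ S
    · simp only [F, if_pos hw]; exact isCompact_frameSet _ _
    · simp only [F, if_neg hw]; exact isCompact_hUnitarySet (hS w hw)
  have hcl : IsClosed ((unitaryPiSubmonoid (cm L) H : Set (InfinitePlace L → Matrix n n ℂ))) := by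
    rw [coe_unitaryPiSubmonoid]; exact isClosed_unitaryPiSet (cm L) H
  have hsub : IsCompact ((Subtype.val : unitaryPiSubmonoid (cm L) H → (InfinitePlace L → Matrix n n ℂ)) ⁻¹'
      Set.univ.pi F) := hcl.isClosedEmbedding_subtypeVal.isCompact_preimage (isCompact_univ_pi hF)
  have hK : (archK L H S T : Set (Uinf L H)) =
      (archEquiv L hdet).toHomeomorph ⁻¹' ((Subtype.val : unitaryPiSubmonoid (cm L) H →
        (InfinitePlace L → Matrix n n ℂ)) ⁻¹' Set.univ.pi F) := by
    ext g
    rw [SetLike.mem_coe, mem_archK_iff_loc_mem_frameSet, Set.mem_preimage, Set.mem_preimage, Set.mem_univ_pi,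
      ContinuousMulEquiv.toHomeomorph_eq_coe]
    show _ ↔ ∀ w, ((archEquiv L hdet g : unitaryPiSubmonoid (cm L) H) : InfinitePlace L → Matrix n n ℂ) w ∈ F w
    rw [coe_archEquiv_eq_loc]
    refine ⟨fun h w => ?_, fun h w hw => ?_⟩
    · by_cases hw : w ∈ S
      · simp only [F, if_pos hw]; exact h w hw
      · simp only [F, if_neg hw]; exact loc_mem_hUnitarySet L H g w
    · have h' := h w
      simp only [F, if_pos hw] at h'
      exact h'
  rw [hK]
  exact (archEquiv L hdet).toHomeomorph.isCompact_preimage.2 hsub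

end Arch

/-! ## §4  PerL's `K_∞ ≤ G_U(ℝ)` for a hermitian space of signature `(2,1), (3,0), …, (3,0)` -/

section PerL

open HodgeCM.PerL34.AdelicUnitaryFactorisation
open Literature.AlgebraicGeometry.ShimuraVarieties (signatureMatrix)

/-- `J_p² = 1` for the signature matrix `J_p = diag(1, …, 1, -1)`. -/
theorem signatureMatrix_mul_self (p : ℕ) : signatureMatrix p * signatureMatrix p = 1 := by
  rw [signatureMatrix, Matrix.diagonal_mul_diagonal, ← Matrix.diagonal_one]
  congr 1
  funext i
  split_ifs <;> norm_num

/-- `J_p` is real: entrywise complex conjugation fixes it. -/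
theorem signatureMatrix_map_conj (p : ℕ) : (signatureMatrix p).map (starRingEnd ℂ) = signatureMatrix p := by
  rw [signatureMatrix, Matrix.diagonal_map (map_zero _)]
  congr 1
  funext i
  split_ifs <;> simp

variable {L : CMField} {ι₁ : L →+* ℂ} (V : HermSpace3 L ι₁)

/-- **PerL's `K_∞`.**  For the hermitian space `V` (signature `(2,1)` at `ι₁`, definite at the other places)
and a frame `T ∈ GL₃(ℂ)`: the subgroup of `G_U(ℝ) = U(H)(L₀ ⊗ ℝ) = Uinf L V.Hm` of elements whose component at
the place of `ι₁` is unitary in the frame `T`.  For a Sylvester frame (`exists_frame_place`) this is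
`U(2) × U(1) × ∏_{w ≠ ι₁} U(3)` in coordinates (`mem_archK_iff_commute`); it is compact for every `T`
(`isCompact_archK`). -/
def _root_.HodgeCM.HermSpace3.archK (T : GL (Fin 3) ℂ) : Subgroup (Uinf L V.Hm) :=
  HodgeCM.PerL34.ArchCompactK.archK L V.Hm {InfinitePlace.mk ι₁} (fun _ => T)

/-- (Ported verbatim from the HodgeCMPerL package; no docstring in the source.) -/
theorem _root_.HodgeCM.HermSpace3.mem_archK_iff (T : GL (Fin 3) ℂ) (g : Uinf L V.Hm) :
    g ∈ V.archK T ↔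
      loc L V.Hm g (InfinitePlace.mk ι₁) ∈ frameSet (V.Hm.map (InfinitePlace.mk ι₁).embedding) T := by
  rw [HermSpace3.archK, HodgeCM.PerL34.ArchCompactK.mem_archK_iff_loc_mem_frameSet]
  simp only [Set.mem_singleton_iff, forall_eq]

/-- **`K_∞` is compact** — hypothesis-free: `det H ≠ 0` is `HermSpace3.det_ne_zero`, definiteness off the place
of `ι₁` is the `posDef_of_ne` field. -/
theorem _root_.HodgeCM.HermSpace3.isCompact_archK (T : GL (Fin 3) ℂ) :
    IsCompact (V.archK T : Set (Uinf L V.Hm)) :=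
  HodgeCM.PerL34.ArchCompactK.isCompact_archK L (isUnit_iff_ne_zero.mpr V.det_ne_zero) _ _ fun w hw =>
    V.posDef_of_ne w.embedding (by
      rw [NumberField.InfinitePlace.mk_embedding]
      exact fun h => hw (Set.mem_singleton_iff.mpr h))


-- port_pkg: scope closed for this part
end PerL
end HodgeCM.PerL34.ArchCompactK
end
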